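import Summits.BirchSwinnertonDyer.BirchSwinnertonDyer.Theorems.BiquadraticEisensteinDescentManinDatumSupercuspidalCMInertTorsionSumRational
import HarnessLib

/-!
# The `(·/q)₄`-twisted `q`-division sums of `E₁*` as rational expressions — the quartic weight and `q = 7`
# (crux `ManinDatumSupercuspidalCMInert`, stub `stub_S7`: the algebraic form of the Bézout-free core `Core₇`, part B)

Summit `BirchSwinnertonDyer`, crux `ManinDatumSupercuspidalCMInert` (stmt-BirchSwinnertonDyer-20111, BED r605), registered stub `stub_S7`.
Width seat bsd-wall-cm-bed-w3 g9 (`--supports 20111`, helper; DICTIONARY LANE). Part A (`…TorsionSumRational`) turned the `Φ`-twisted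
`q`-division sums of `E₁*` into `½℘′(w)·Σ_b Φ(b)/(℘(w) − ℘(v_b))` for any even `q`-periodic weight with vanishing character sum. Here:

* §3 `charSum_eq_zero` — `Σ_{b mod q} Φ(b) = 0` from ONE twisting witness (`Φ(g x) = cΦ(x)`, `c ≠ 1`, `g` invertible mod `q`; re-index `b ↦ g·b`);
* §4 the weight `Φ = \overline{(·/q)₄}^k` (`quarticCharMod q`, p635076): even (`(−1/q)₄ = 1`), `Φ(0) = 0`, multiplicative;
  ★ `torsionSum_quartic_eq_of_charSum` (any inert prime `q ≡ 3 (4)`, given `\overline{(i/q)₄}^k = 1` and the character sum);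
* §5 `q = 7`: `((2+i)/7)₄ = i` (`(2+i)¹² ≡ i (mod 7)`), `(i/7)₄ = 1`, `charSum_seven_eq_zero` (`k = 1,2,3`), and
  ★★ `torsionSum_seven_eq`: **`T_k(w) = Σ_{b mod 7} \overline{(b/7)₄}^k E₁*(w − b̄/7) = ½ ℘(w)℘′(w) · Σ_{b mod 7} \overline{(b/7)₄}^k/(℘(w)² − ℘(b̄/7)²)`**
  for `k ∈ {1,2,3}`, `w ∉ ℤi + ℤ`, `M′w ∈ ℤi + ℤ`, `7 ∤ M′`.

So `Core₇` (`…TorsionCoreBezoutFree`) is a statement about ONE rational function `Σ_b \overline{(b/7)₄}^k/(X − ℘(b̄/7)²)` of `X = ℘(w)²`, whose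
poles are the twelve squares of the roots of the `7`-division polynomial (bed-w4 g10's `preΨ'_seven_lemniscate`) and whose numerator
coefficients are fixed algebraic numbers (elliptic Gauss sums) — a finite `7`-adic certificate target. HONEST FRAMING: identities only;
nothing here bounds a valuation or proves `Core₇`, the stub, the crux, Manin's conjecture or BSD. No definition, no named fact, no `sorry`.
-/

set_option autoImplicit false
-- the summit namespace `Summit.BirchSwinnertonDyer.BirchSwinnertonDyer.…` (summit = problem) trips `dupNamespace` on every declaration
set_option linter.dupNamespace false

noncomputable section

open scoped ComplexConjugate
open Complex PeriodPair
open Literature.NumberTheory.EllipticCurves Literature.NumberTheory.EllipticCurves.GaussianLattice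
open Literature.NumberTheory.LFunctions Literature.NumberTheory.LFunctions.GaussianTheta
open Literature.NumberTheory.QuadraticFields.GaussianQuarticSymbol

namespace Summit.BirchSwinnertonDyer.BirchSwinnertonDyer.Theorems.BiquadraticEisensteinDescentManinDatumSupercuspidalCMInertTorsionSumRational

open Summit.BirchSwinnertonDyer.BirchSwinnertonDyer.Theorems.BiquadraticEisensteinDescentManinDatumSupercuspidalCMInertTorsionCoreBezoutFree
  (phiq_intCast_mul phiq_periodic isCoprime_of_not_dvd)

/-! ## §3 Vanishing of the character sum `Σ_{b mod q} Φ(b)` from one twisting witness -/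

section CharSum

variable (q : ℕ) [NeZero q]

omit [NeZero q] in
/-- Two Gaussian integers have the same class modulo `q` iff they differ by a multiple of `q`. [folklore] -/
theorem cls_eq_cls_iff (x x' : GaussianInt) : cls q x = cls q x' ↔ (q : GaussianInt) ∣ x' - x := by
  rw [show (q : GaussianInt) = ((q : ℤ) : GaussianInt) by simp, Zsqrtd.intCast_dvd, Zsqrtd.re_sub, Zsqrtd.im_sub,
    ← ZMod.intCast_eq_intCast_iff_dvd_sub, ← ZMod.intCast_eq_intCast_iff_dvd_sub]
  simp only [cls, Prod.mk.injEq]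

/-- **`Σ_{b mod q} Φ(b) = 0`** for a `q`-periodic weight admitting a twisting witness: `Φ(g·x) = c·Φ(x)` with `c ≠ 1` for some `g`
invertible modulo `q` (`q ∣ g h − 1`) — re-index the sum by `b ↦ g·b`. [folklore] -/
theorem charSum_eq_zero {Φ : GaussianInt → ℂ} (hΦper : ∀ x y : GaussianInt, Φ (x + q * y) = Φ x) {g h : GaussianInt} {c : ℂ}
    (hΦg : ∀ x : GaussianInt, Φ (g * x) = c * Φ x) (hc : c ≠ 1) (hgh : (q : GaussianInt) ∣ g * h - 1) :
    ∑ b : ZMod q × ZMod q, Φ (rep q b 0) = 0 := by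
  set σ : ZMod q × ZMod q → ZMod q × ZMod q := fun b ↦ cls q (g * rep q b 0) with hσ
  have hσinj : Function.Injective σ := by
    intro b b' hbb'
    have h1 : (q : GaussianInt) ∣ g * rep q b' 0 - g * rep q b 0 := (cls_eq_cls_iff q _ _).mp hbb'
    have h2 : (q : GaussianInt) ∣ rep q b' 0 - rep q b 0 := by
      obtain ⟨t, ht⟩ := hgh
      obtain ⟨u, hu⟩ := h1
      refine ⟨h * u - t * (rep q b' 0 - rep q b 0), ?_⟩
      linear_combination (-(rep q b' 0 - rep q b 0)) * ht + h * hu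
    have h3 : cls q (rep q b 0) = cls q (rep q b' 0) := (cls_eq_cls_iff q _ _).mpr h2
    rwa [cls_rep, cls_rep] at h3
  have hσbij : Function.Bijective σ := Finite.injective_iff_bijective.mp hσinj
  have hS : ∑ b : ZMod q × ZMod q, Φ (rep q b 0) = c * ∑ b : ZMod q × ZMod q, Φ (rep q b 0) := by
    rw [Finset.mul_sum]
    refine (Fintype.sum_bijective σ hσbij (fun b ↦ c * Φ (rep q b 0)) (fun b ↦ Φ (rep q b 0)) fun b ↦ ?_).symm
    -- `rep(σ b) = g·rep(b) + q·y`
    obtain ⟨y, hy⟩ := exists_rep_eq q (c := σ b) (x := g * rep q b 0) rfl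
    have h' := rep_eq_rep_zero_add q (σ b) y
    rw [hy] at h'
    rw [show rep q (σ b) 0 = g * rep q b 0 + q * (-⟨y.1, y.2⟩) by linear_combination (-1 : GaussianInt) * h', hΦper, hΦg]
  have : (1 - c) * ∑ b : ZMod q × ZMod q, Φ (rep q b 0) = 0 := by linear_combination hS
  rcases mul_eq_zero.mp this with h0 | h0
  · exact absurd (sub_eq_zero.mp h0).symm hc
  · exact h0

end CharSum

/-! ## §4 The weight `Φ = \overline{(·/q)₄}^k` -/

section Quartic

variable {q : ℕ} (hq : q.Prime) (hq3 : q % 4 = 3)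
include hq hq3

/-- `\overline{(−x/q)₄}^k = \overline{(x/q)₄}^k` (`(−1/q)₄ = 1`). [cite: IrelandRosen1982, Ch. 9 §8, Prop. 9.8.4] -/
theorem phiq_neg (k : ℕ) (x : GaussianInt) :
    (conj (((quarticCharMod q (-x) : GaussianInt) : ℂ))) ^ k = (conj (((quarticCharMod q x : GaussianInt) : ℂ))) ^ k := by
  have h := phiq_intCast_mul hq hq3 k (f := -1) (isCoprime_one_left.neg_left) x
  rwa [Int.cast_neg, Int.cast_one, neg_one_mul] at h

/-- `\overline{(0/q)₄}^k = 0` for `k ≠ 0`. [cite: IrelandRosen1982, Ch. 9 §8, Prop. 9.8.3 (a)] -/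
theorem phiq_zero {k : ℕ} (hk : k ≠ 0) : (conj (((quarticCharMod q 0 : GaussianInt) : ℂ))) ^ k = 0 := by
  rw [(quarticCharMod_natCast_eq_zero_iff hq hq3 0).mpr (dvd_zero _), map_zero, map_zero, zero_pow hk]

omit hq hq3 in
/-- `\overline{(ix/q)₄}^k = \overline{(i/q)₄}^k · \overline{(x/q)₄}^k` (multiplicativity). [cite: IrelandRosen1982, Ch. 9 §8, Prop. 9.8.3 (b)] -/
theorem phiq_I_mul (k : ℕ) (x : GaussianInt) :
    (conj (((quarticCharMod q (⟨0, 1⟩ * x) : GaussianInt) : ℂ))) ^ k =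
      (conj (((quarticCharMod q ⟨0, 1⟩ : GaussianInt) : ℂ))) ^ k * (conj (((quarticCharMod q x : GaussianInt) : ℂ))) ^ k := by
  rw [quarticCharMod_mul, GaussianInt.toComplex_mul, map_mul, mul_pow]

omit hq hq3 in
/-- `\overline{(gx/q)₄}^k = \overline{(g/q)₄}^k · \overline{(x/q)₄}^k`. [cite: IrelandRosen1982, Ch. 9 §8, Prop. 9.8.3 (b)] -/
theorem phiq_mul (k : ℕ) (g x : GaussianInt) :
    (conj (((quarticCharMod q (g * x) : GaussianInt) : ℂ))) ^ k =
      (conj (((quarticCharMod q g : GaussianInt) : ℂ))) ^ k * (conj (((quarticCharMod q x : GaussianInt) : ℂ))) ^ k := by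
  rw [quarticCharMod_mul, GaussianInt.toComplex_mul, map_mul, mul_pow]

/-- ★ **The `(·/q)₄^k`-twisted `q`-division sums as rational expressions** (generic inert `q ≡ 3 (4)`, `k ≠ 0`): if `\overline{(i/q)₄}^k = 1`
and the character sum `Σ_{b mod q} \overline{(b/q)₄}^k` vanishes, then for every `w ∉ Λ` with `M′w ∈ Λ`, `M′` prime to `q`,
`T_k(w) = Σ_b \overline{(b/q)₄}^k E₁*(w − b̄/q) = ½ ℘(w)℘′(w) · Σ_b \overline{(b/q)₄}^k/(℘(w)² − ℘(b̄/q)²)`. [folklore] -/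
theorem torsionSum_quartic_eq_of_charSum [NeZero q] {k : ℕ} (hk : k ≠ 0)
    (hεk : (conj (((quarticCharMod q ⟨0, 1⟩ : GaussianInt) : ℂ))) ^ k = 1)
    (hsum : ∑ b : ZMod q × ZMod q, (conj (((quarticCharMod q (rep q b 0) : GaussianInt) : ℂ))) ^ k = 0)
    {M' : ℕ} (hM : M'.Coprime q) {w : ℂ} (hw : w ∉ (ofUpperHalfPlane UpperHalfPlane.I).lattice)
    (hMw : (M' : ℂ) * w ∈ (ofUpperHalfPlane UpperHalfPlane.I).lattice) :
    ∑ b : ZMod q × ZMod q, (conj (((quarticCharMod q (rep q b 0) : GaussianInt) : ℂ))) ^ k *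
        kroneckerE₁ (w - conj ((rep q b 0 : GaussianInt) : ℂ) / q) =
      (1 / 2 : ℂ) * ℘[ofUpperHalfPlane UpperHalfPlane.I] w * ℘'[ofUpperHalfPlane UpperHalfPlane.I] w *
        ∑ b : ZMod q × ZMod q, (conj (((quarticCharMod q (rep q b 0) : GaussianInt) : ℂ))) ^ k /
          (℘[ofUpperHalfPlane UpperHalfPlane.I] w ^ 2 - ℘[ofUpperHalfPlane UpperHalfPlane.I] (conj ((rep q b 0 : GaussianInt) : ℂ) / q) ^ 2) := by
  have hΦper : ∀ x y : GaussianInt, (conj (((quarticCharMod q (x + q * y) : GaussianInt) : ℂ))) ^ k =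
      (conj (((quarticCharMod q x : GaussianInt) : ℂ))) ^ k := phiq_periodic k
  have hΦI : ∀ x : GaussianInt, (conj (((quarticCharMod q (⟨0, 1⟩ * x) : GaussianInt) : ℂ))) ^ k =
      (conj (((quarticCharMod q x : GaussianInt) : ℂ))) ^ k := fun x ↦ by rw [phiq_I_mul, hεk, one_mul]
  have h1 := torsionSum_eq_half_deriv_mul_sum q (Φ := fun x ↦ (conj (((quarticCharMod q x : GaussianInt) : ℂ))) ^ k)
    hΦper (phiq_neg hq hq3 k) (phiq_zero hq hq3 hk) hsum hM hw hMw
  have h2 := sum_div_sub_eq_mul_sum_div_sq_sub q (Φ := fun x ↦ (conj (((quarticCharMod q x : GaussianInt) : ℂ))) ^ k)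
    hΦper hΦI (phiq_zero hq hq3 hk) (X := ℘[ofUpperHalfPlane UpperHalfPlane.I] w)
    (fun b hb ↦ weierstrassP_ne_of_torsion q hM hw hMw hb)
  beta_reduce at h1 h2
  rw [h1, h2]
  ring

end Quartic

/-! ## §5 `q = 7` -/

section Seven

/-- `(2+i)¹² − i = 7·(1679 − 1471 i)`: Euler's criterion datum for `((2+i)/7)₄ = i`. [folklore] -/
theorem seven_dvd_pow_twelve_sub_I :
    (((7 : ℕ) : GaussianInt)) ∣ (⟨2, 1⟩ : GaussianInt) ^ (((7 : ℕ) ^ 2 - 1) / 4) - ⟨0, 1⟩ :=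
  ⟨⟨1679, -1471⟩, by decide⟩

/-- **`((2 + i)/7)₄ = i`** (Euler's criterion: `(2+i)¹² ≡ i (mod 7)`). [cite: IrelandRosen1982, Ch. 9 §8, Prop. 9.8.2 and Definition] -/
theorem quarticCharMod_seven_two_add_I : quarticCharMod (7 : ℕ) ⟨2, 1⟩ = ⟨0, 1⟩ :=
  quarticCharMod_natCast_eq_of_pow_four_eq_one (q := 7) (by norm_num) (by norm_num) (by decide) seven_dvd_pow_twelve_sub_I

/-- **`(i/7)₄ = 1`** (`i¹² = 1`). [cite: IrelandRosen1982, Ch. 9 §8, Prop. 9.8.6 (proof)] -/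
theorem quarticCharMod_seven_I : quarticCharMod (7 : ℕ) ⟨0, 1⟩ = 1 := by
  have hu : IsUnit (⟨0, 1⟩ : GaussianInt) := ⟨⟨⟨0, 1⟩, ⟨0, -1⟩, by decide, by decide⟩, rfl⟩
  rw [quarticCharMod_natCast_of_isUnit (q := 7) (by norm_num) (by norm_num) hu]
  decide

/-- **The character sum `Σ_{b mod 7} \overline{(b/7)₄}^k` vanishes for `k = 1, 2, 3`** (twisting witness `g = 2 + i`, `(g/7)₄ = i`,
`\overline{i}^k ≠ 1`; inverse `h = 6 − 3i`, `(2+i)(6−3i) = 15 ≡ 1 (mod 7)`). [cite: IrelandRosen1982, Ch. 9 §8, Prop. 9.8.3 (b)] -/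
theorem charSum_seven_eq_zero {k : ℕ} (hk1 : 1 ≤ k) (hk3 : k ≤ 3) :
    ∑ b : ZMod 7 × ZMod 7, (conj (((quarticCharMod (7 : ℕ) (rep 7 b 0) : GaussianInt) : ℂ))) ^ k = 0 := by
  refine charSum_eq_zero 7 (Φ := fun x ↦ (conj (((quarticCharMod (7 : ℕ) x : GaussianInt) : ℂ))) ^ k) (phiq_periodic k)
    (h := ⟨6, -3⟩) (phiq_mul k ⟨2, 1⟩) ?_ ⟨2, by decide⟩
  rw [quarticCharMod_seven_two_add_I, show (((⟨0, 1⟩ : GaussianInt)) : ℂ) = I by rw [GaussianInt.toComplex_def]; simp,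
    Complex.conj_I]
  interval_cases k <;> norm_num [Complex.ext_iff, pow_succ]

/-- ★★ **The Bézout-free core sums of `stub_S7` as rational expressions.** For `k ∈ {1,2,3}` and every `w ∉ ℤi + ℤ` with `M′w ∈ ℤi + ℤ`,
`7 ∤ M′`: `T_k(w) = Σ_{b mod 7} \overline{(b/7)₄}^k E₁*(w − b̄/7) = ½ ℘(w)℘′(w) · Σ_{b mod 7} \overline{(b/7)₄}^k/(℘(w)² − ℘(b̄/7)²)` — no
Eisenstein–Kronecker function left: `Core₇` (`…TorsionCoreBezoutFree`) is a statement about the values of ONE rational function of `℘(w)²`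
with poles at the twelve squares `℘(b̄/7)²` of the `7`-division values. [folklore] -/
theorem torsionSum_seven_eq {k : ℕ} (hk1 : 1 ≤ k) (hk3 : k ≤ 3) {M' : ℕ} (hM : M'.Coprime 7)
    {w : ℂ} (hw : w ∉ (ofUpperHalfPlane UpperHalfPlane.I).lattice)
    (hMw : (M' : ℂ) * w ∈ (ofUpperHalfPlane UpperHalfPlane.I).lattice) :
    ∑ b : ZMod 7 × ZMod 7, (conj (((quarticCharMod 7 (rep 7 b 0) : GaussianInt) : ℂ))) ^ k *
        kroneckerE₁ (w - conj ((rep 7 b 0 : GaussianInt) : ℂ) / 7) =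
      (1 / 2 : ℂ) * ℘[ofUpperHalfPlane UpperHalfPlane.I] w * ℘'[ofUpperHalfPlane UpperHalfPlane.I] w *
        ∑ b : ZMod 7 × ZMod 7, (conj (((quarticCharMod 7 (rep 7 b 0) : GaussianInt) : ℂ))) ^ k /
          (℘[ofUpperHalfPlane UpperHalfPlane.I] w ^ 2 - ℘[ofUpperHalfPlane UpperHalfPlane.I] (conj ((rep 7 b 0 : GaussianInt) : ℂ) / 7) ^ 2) := by
  have h := torsionSum_quartic_eq_of_charSum (q := 7) (by norm_num) (by norm_num) (k := k) (by omega)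
    (by rw [quarticCharMod_seven_I, map_one, map_one, one_pow]) (charSum_seven_eq_zero hk1 hk3) hM hw hMw
  exact_mod_cast h

end Seven

end Summit.BirchSwinnertonDyer.BirchSwinnertonDyer.Theorems.BiquadraticEisensteinDescentManinDatumSupercuspidalCMInertTorsionSumRational

end
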